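import Summits.ABC.IUTFork.Joshi.ArithmeticoidPeriods
import Mathlib.Algebra.Ring.Aut
import Mathlib.GroupTheory.OrderOfElement

/-!
# Joshi, *ATS II½ — Deformations of Number Fields* (arXiv:2305.10398) §4.4 and §4.6: Thm. 4.4.1, Cor. 4.4.2, Cor. 4.6.1
# (the `L*`-action's kernel; the actions on `B_L`) — typed, no side taken

Third companion of `Joshi/Arithmeticoids.lean` (block E, rung LADDER-ABC:A2.E, seat abc-iut-E-t37; the §4 part of the «[J-2½] in-scope
remainder», plan/E/ASSIGNMENTS.md batch-3 slot book 07:46Z: §5 remainder = seat E-t46's `Joshi/Arithmeticoids2.lean`). Same source, render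
and conventions: [J-2½] = K. Joshi, arXiv:2305.10398, lit key `paper:arxiv-2305.10398`, bib `Joshi2023ATS2half`, «p.N l.M» = line M of
`HOME/plan/repair/lit/renders/Joshi-arxiv-2305.10398-ATS2half/pNNNN.txt`. TAKES NO SIDE on [IUTchIII] Cor. 3.12, on Joshi's claims, or on
Mochizuki's reports on them; typed ≠ proved; typed AS A CANDIDATE ≠ endorsed; every statement print ASSERTS is a `def … : Prop` with
`@[claim "Joshi2023ATS2half" "disputed"]`, never an axiom / instance / theorem; what FOLLOWS from the typed signature is a proved `theorem`.

CONTENTS (node ids of `HOME/plan/E/JOSHI-DAG.tsv`):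
* J2h:Thm4.4.1 `UnitActsTriviallyIffRootOfUnity` (claim), J2h:Cor4.4.2 `Cor442` (claim, as printed) with the LOCATED kernel fact
  `not_noNontrivialRootsOfUnity` (its hypothesis «`L` does not contain any non-trivial roots of unity» fails in every field of
  characteristic `≠ 2`, `−1` being one — so the printed corollary is vacuous as stated; no verdict on the intended reading «`μ(L) = {±1}`»).
* J2h:Cor4.6.1 — signature `BActionDatum` (the local actions of `G_v`, `L*`, `Aut_{𝒪_{L_v}}(𝒢(𝒪_{F_v}))` on `B_{L_v}` by ring
  automorphisms) with the factorwise CONSTRUCTIONS `galActionB`, `unitActionB`, `ltActionB` on `B_L` and the claims (1) `Cor461_1`,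
  (3) `Cor461_3`, (4) `Cor461_4` («preserves / acts on `B_L(1)`»); (2) is prose (the dictionary «`B_L` = functions on `𝒴_L`», Rmk. 4.5.2).
* REMARKS recorded as locators only (prose, no declaration): Rmk. 4.2.6 (p.24 l.7–38: `ϕ` and `L*` as proxies of a global Frobenius;
  (3) «moving in a Frobenius orbit … corresponds to moving in the vertical column of log-links in [Mochizuki, 2021c]» — a DICTIONARY
  hint for E3 row D-07, not bound here), Rmk. 4.2.7 (p.24 l.39 – p.25 l.13: `G_L ↷ 𝒴_L` is not determined by the topological type of
  `G_L` [Joshi 2020b]; «the origin of Mochizuki's Indeterminacy Ind1 from my point of view» — E6/E3 locator), Rmk. 4.4.3 (p.26 l.31–32: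
  «Mochizuki makes a similar but less precise assertion in [Mochizuki, 2021c, Remark 1.2.3(ii)]»), Rmk. 4.4.4 (the stacky quotient
  `[𝒴_L/L*]` as «the correct `𝒳_L`»), Rmk. 4.5.2.
* NOT TYPED, LOCATED: J2h:Thm4.3.1 (p.25 l.14–89, correspondences `σ(y) = Σ_{j=1}^n (y_j)`, `n ≤ [L:ℚ]`): the printed `y_j :=
  (y″_{v,j})_{v ∈ V_L}` presupposes a simultaneous labelling `j` of the fibres `f_v^{-1}(y″_v)` at all places; the product-of-fibres
  reading is not a finite formal sum. Cited by no S-spine node; left to the faithfulness lane.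
-/

noncomputable section

open TopologicalSpace

namespace Summit.ABC.IUTFork.Joshi.ATS2h

/-- «`L` does not contain any non-trivial roots of unity» (hypothesis of [J-2½] Cor. 4.4.2, p.26 l.29–30), read literally: every
element of finite order of `L*` is `1`. [claim: Joshi2023ATS2half, status: disputed] -/
def NoNontrivialRootsOfUnity (L : Type) [Field L] : Prop := ∀ x : Lˣ, IsOfFinOrder x → x = 1

/-- LOCATED (kernel): the literal hypothesis of Cor. 4.4.2 fails whenever `2 ≠ 0` in `L` (so in every number field): `−1 ∈ L*` has
finite order and is `≠ 1`. No verdict on the intended reading. [folklore] -/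
theorem not_noNontrivialRootsOfUnity (L : Type) [Field L] (h2 : (2 : L) ≠ 0) : ¬ NoNontrivialRootsOfUnity L := by
  intro h
  have hfin : IsOfFinOrder (-1 : Lˣ) := isOfFinOrder_iff_pow_eq_one.2 ⟨2, two_pos, by simp⟩
  have h1 : ((-1 : Lˣ) : L) = ((1 : Lˣ) : L) := by rw [h (-1) hfin]
  simp only [Units.val_neg, Units.val_one] at h1
  exact h2 (by linear_combination -h1)

/-! ## Signatures used below (carriers explicit; HYPOTHESIS structures, nothing asserted) -/

/-- **SIGNATURE for [J-2½] §4.6** (Cor. 4.6.1, p.27 l.24–37: «now clear from the preceding results and definitions»): the local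
actions on `B_{L_v}` by ring automorphisms of `G_v` ([FF18] functoriality), of `L* ⊂ L_v*` (Lubin–Tate / Frobenius, as on `|Y|`)
and of `Aut_{𝒪_{L_v}}(𝒢(𝒪_{F_v}))` ([J-I]). [claim: Joshi2023ATS2half, status: disputed] -/
structure BActionDatum (L : Type) [Field L] {V : Type} (B : V → Type) [∀ v, CommRing (B v)] (G A : V → Type)
    [∀ v, Group (G v)] [∀ v, Group (A v)] : Type where
  /-- `G_v ↷ B_{L_v}` -/
  galB : (v : V) → G v →* RingAut (B v)
  /-- `L* ↷ B_{L_v}` -/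
  actB : (v : V) → Lˣ →* RingAut (B v)
  /-- `Aut_{𝒪_{L_v}}(𝒢(𝒪_{F_v})) ↷ B_{L_v}` -/
  ltB : (v : V) → A v →* RingAut (B v)

namespace BActionDatum

variable {L : Type} [Field L] {V : Type} {B : V → Type} [∀ v, CommRing (B v)] {G A : V → Type} [∀ v, Group (G v)]
  [∀ v, Group (A v)] (T : BActionDatum L B G A)

/-- **[J-2½] Cor. 4.6.1 (1), the action** (p.27 l.27): «there is a natural action of `G_L` on `B_L`», CONSTRUCTED factorwise.
[claim: Joshi2023ATS2half, status: disputed] -/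
def galActionB : ((v : V) → G v) →* RingAut ((v : V) → B v) where
  toFun g := RingEquiv.piCongrRight fun v => T.galB v (g v)
  map_one' := by ext x v; simp
  map_mul' g h := by ext x v; simp

/-- **[J-2½] Cor. 4.6.1 (2), the action** (p.27 l.28–29): «a natural action of `L*` on `B_L` which corresponds to the `L*` action on
`𝒴_L` constructed above» (the correspondence is the dictionary of Rmk. 4.5.2, prose). [claim: Joshi2023ATS2half, status: disputed] -/
def unitActionB : Lˣ →* RingAut ((v : V) → B v) where
  toFun x := RingEquiv.piCongrRight fun v => T.actB v x
  map_one' := by ext b v; simp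
  map_mul' x x' := by ext b v; simp

/-- **[J-2½] Cor. 4.6.1 (4), the action** (p.27 l.33–37): «a natural action of `∏_{v ∈ V^non_L} Aut_{𝒪_{L_v}}(𝒢(𝒪_{F_v}))`»,
CONSTRUCTED factorwise on `B_L`. [claim: Joshi2023ATS2half, status: disputed] -/
def ltActionB : ((v : V) → A v) →* RingAut ((v : V) → B v) where
  toFun σ := RingEquiv.piCongrRight fun v => T.ltB v (σ v)
  map_one' := by ext b v; simp
  map_mul' σ τ := by ext b v; simp

end BActionDatum

namespace DeformationDatum

variable {L : Type} [Field L] {V : Type} {Lv : V → Type} [∀ v, Field (Lv v)] {Y : V → Type}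
  [∀ v, TopologicalSpace (Y v)] {K : (v : V) → Y v → Type} [∀ v y, Field (K v y)] [∀ v y, TopologicalSpace (K v y)]
  {G : V → Type} [∀ v, Group (G v)] {A : V → Type} [∀ v, Group (A v)]
  (D : DeformationDatum L V Lv Y K G A)

/-! ## §4.4 A fundamental property of the `L*`-action (Thm. 4.4.1, Cor. 4.4.2) -/

/-- **[J-2½] Thm. 4.4.1** (p.26 l.3; proof l.4–28 via Kronecker's theorem): «let `α ∈ L*`. Then `α` acts trivially on `𝒴_L` if and
only if `α ∈ L` is a root of unity.» [claim: Joshi2023ATS2half, status: disputed] -/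
@[claim "Joshi2023ATS2half" "disputed"]
def UnitActsTriviallyIffRootOfUnity : Prop := ∀ x : Lˣ, D.unitAction x = 1 ↔ IsOfFinOrder x

/-- **[J-2½] Cor. 4.4.2** (p.26 l.29–30), AS PRINTED: «let `L` be a number field with no real embeddings and assume that `L` does not
contain any non-trivial roots of unity, then the `L*`-action on `𝒴_L` has trivial stabilizers.» See `not_noNontrivialRootsOfUnity`:
the hypothesis is unsatisfiable as printed (LOCATED, no verdict on the intended `μ(L) = {±1}` reading). [claim: Joshi2023ATS2half,
status: disputed] -/
@[claim "Joshi2023ATS2half" "disputed"]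
def Cor442 : Prop := NoNontrivialRootsOfUnity L → ∀ (x : Lˣ) (y : D.Ycal), D.unitAction x y = y → x = 1

/-! ## §4.6 Fundamental actions on `B_L` (Cor. 4.6.1, the claims) -/

namespace BRingDatum

variable {D} {B : V → Type} [∀ v, CommRing (B v)] [∀ v, TopologicalSpace (B v)] [∀ v, Algebra (Lv v) (B v)]
  (R : D.BRingDatum B) (T : BActionDatum L B G A)

/-- **[J-2½] Cor. 4.6.1 (1), the claim** (p.27 l.27): the `G_L`-action «preserves `B_L(1)`». [claim: Joshi2023ATS2half, status: disputed] -/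
@[claim "Joshi2023ATS2half" "disputed"]
def Cor461_1 : Prop := ∀ (g : (v : V) → G v) (b : R.BL), b ∈ R.BLone → T.galActionB g b ∈ R.BLone

/-- **[J-2½] Cor. 4.6.1 (3)** (p.27 l.30–32): «the natural action of `𝒪^⊳_L ⊂ L*` on `B_L` preserves `B_L(1)`» — over a chosen subring
`𝒪_L ⊂ L` (the ring of integers; a parameter, since the signature carries `L` as an abstract field). [claim: Joshi2023ATS2half,
status: disputed] -/
@[claim "Joshi2023ATS2half" "disputed"]
def Cor461_3 (OL : Subring L) : Prop :=
  ∀ x : Lˣ, (x : L) ∈ OL → ∀ b : R.BL, b ∈ R.BLone → T.unitActionB x b ∈ R.BLone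

/-- **[J-2½] Cor. 4.6.1 (4), the claim** (p.27 l.33–37): the `∏_v Aut_{𝒪_{L_v}}(𝒢(𝒪_{F_v}))`-action is «on `B_L(1)`» (preserves it).
[claim: Joshi2023ATS2half, status: disputed] -/
@[claim "Joshi2023ATS2half" "disputed"]
def Cor461_4 : Prop := ∀ (σ : (v : V) → A v) (b : R.BL), b ∈ R.BLone → T.ltActionB σ b ∈ R.BLone

end BRingDatum

end DeformationDatum

end Summit.ABC.IUTFork.Joshi.ATS2h
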